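import Literature.Geometry.Kaehler.ComplexTorusLatticeExteriorAlgebra
import Literature.Geometry.Kaehler.ComplexTorusLatticeGroupCohomologyNaturality
import HarnessLib

/-!
# `Hⁿ(f) = ⋀ⁿ H¹(f)`: the identification `Hⁿ(X, ℤ) ≅ ⋀ⁿ Hom(Λ, ℤ)` is natural in the complex torus
# (Lange §1.1.2–1.1.3, §1.1.6 Ex. (13); Brown V §6 p. 129: "`ψ` is a natural map of functors of `G`")

Layer `Literature/Geometry/Kaehler`, namespace `Literature.Geometry.Kaehler.ComplexTorus`; lane
`lit-hodgefound` (Track 2, Layer A), seat p30 gen 8, row g8-#3 of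
`run/shared/lean/pub/lit-hodgefound/SKELETON.md`.  One definition with body (`homPullback`) and
theorems; NO named fact, no `sorry`.

Sources followed. H. Lange, *Abelian Varieties over the Complex Numbers* (Springer 2023) [held copy
`book:lange1992-complex-abelian-varieties`]: §1.1.2 (a homomorphism `f : X = V/Λ → X' = V'/Λ'` of
complex tori is given by its analytic representation `ρₐ(f) : V → V'` restricting to the rational
representation `ρ_r(f) : Λ → Λ'`), §1.1.3 Lemma 1.1.17 / Cor. 1.1.18 [p0023] ("There is a canonical
isomorphism `H¹(X, ℤ) → Hom(Λ, ℤ)`", "`H²(X, ℤ) ≅ Alt²(Λ, ℤ) := ⋀² Hom(Λ, ℤ)`", all `n` by §1.1.6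
Ex. (7) [p0027]) and §1.1.6 Ex. (13) [p0028] (the CANONICAL `φₙ : Hⁿ(Λ, ℤ) → Hⁿ(X, ℤ)`); K. S. Brown,
*Cohomology of Groups* (1982), V §6 [p0129 L5]: "It is an obvious but important fact that `ψ` is a
natural map of functors of `G`."  Canonical identifications are compatible with pullbacks: for the
homomorphism `f_A : X → X'` with rational representation `A : Matrix ι' ι ℤ`, the pullback
`f_A^* : Hⁿ(X', ℤ) → Hⁿ(X, ℤ)` IS the `n`-th exterior power of `f_A^* = ρ_r(f_A)^∨ : Hom(Λ', ℤ) → Hom(Λ, ℤ)`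
under `Hⁿ(·, ℤ) ≅ ⋀ⁿ Hom(·, ℤ)`.

In the tree (all BY NAME): the sibling `ComplexTorusLatticeExteriorAlgebra` (seat p30 gen 8:
`latticeExteriorPowerFormsEquiv Φ n : ⋀[ℤ]^n Hom(Λ, ℤ) ≃+ integralForms Φ n`), the algebraic engine
`Literature/Algebra/Homology/FreeAbelianCohomologyExteriorAlgebra` (`latticeExteriorPowerHomEquivCohomology`,
its naturality lemma `map_charCupClass`), and `ComplexTorusLatticeGroupCohomologyNaturality` (seat p30
gen 5: `latticeHom A = ρ_r(f_A)`, `groupCohomologyPullback A n = Hⁿ(ρ_r(f_A), id)`,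
`groupCohomologyForm_map`: `φₙ(f_A^* x) = (φ'ₙ x) ∘ ρₐ(f_A)`).

* §1 `homPullback A : Hom(Λ', ℤ) →ₗ[ℤ] Hom(Λ, ℤ)`, `θ ↦ θ ∘ ρ_r(f_A)` (the transpose of `A`:
  `homPullback_latticeCoord`, `e'*_{a'} ↦ Σ_a A_{a' a} e*_a`).
* §2 **`groupCohomologyPullback_latticeExteriorPowerHomEquivCohomology`** (group side):
  `f_A^*(θ₁ ∧ ⋯ ∧ θₙ) = f_A^*θ₁ ∧ ⋯ ∧ f_A^*θₙ`, i.e. `Hⁿ(ρ_r(f_A), id) ∘ (⋀ⁿ Hom(Λ', ℤ) ≅ Hⁿ(Λ', ℤ)) =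
  (⋀ⁿ Hom(Λ, ℤ) ≅ Hⁿ(Λ, ℤ)) ∘ ⋀ⁿ(homPullback A)`.
* §3 **`latticeExteriorPowerFormsEquiv_map`** (torus side): under `Hⁿ(X, ℤ) ≅ ⋀ⁿ Hom(Λ, ℤ)` the
  pullback of invariant integral forms `γ ↦ γ ∘ ρₐ(f_A)` (`realRep Φ Φ' A`) is `⋀ⁿ(homPullback A)`:
  `(⋀ⁿ(f_A^*) x)^{form} = x^{form} ∘ realRep Φ Φ' A`; `coe_latticeExteriorPowerFormsEquiv_ιMulti_homPullback`
  (on decomposables), `latticeExteriorPowerFormsEquiv_symm_comp_realRep`.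
* §4 `coe_latticeExteriorPowerFormsEquiv_ιMulti_append`: `(θ ∧ θ')^{form} = θ^{form} ∧ θ'^{form}` — the
  identification is multiplicative on decomposables (cup product = exterior product).

## References
* H. Lange, *Abelian Varieties over the Complex Numbers*, Grundlehren Text Edition, Springer (2023),
  §1.1.2, §1.1.3 Lemma 1.1.17, Cor. 1.1.18, §1.1.6 Exercises (7), (13). [Lange2023AbelianVarietiesComplex]
* K. S. Brown, *Cohomology of Groups*, GTM 87, Springer (1982), V §6 p. 129, Thm. 6.4.
  [Brown1982CohomologyGroups]
-/

noncomputable section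

open Function CategoryTheory groupCohomology Multiplicative

namespace Literature.Geometry.Kaehler

namespace ComplexTorus

open Literature.Algebra.Homology

/-! ### §1 The pullback of characters `θ ↦ θ ∘ ρ_r(f_A)` -/

section Characters

variable {ι ι' : Type} [Fintype ι]

/-- **`f_A^* = ρ_r(f_A)^∨ : Hom(Λ', ℤ) → Hom(Λ, ℤ)`, `θ ↦ θ ∘ ρ_r(f_A)`** — the action of the
homomorphism `f_A` on `H¹ = Hom(Λ, ℤ)` (Lemma 1.1.17 (a)), `ℤ`-linear. [cite: Lange2023AbelianVarietiesComplex, §1.1.2 and §1.1.3 Lemma 1.1.17 (a)] -/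
def homPullback (A : Matrix ι' ι ℤ) :
    (Additive (Multiplicative (ι' → ℤ)) →+ ℤ) →ₗ[ℤ] (Additive (Multiplicative (ι → ℤ)) →+ ℤ) where
  toFun θ := θ.comp (MonoidHom.toAdditive (latticeHom A))
  map_add' _ _ := rfl
  map_smul' _ _ := rfl

/-- `homPullback A θ = θ ∘ ρ_r(f_A)`. [cite: Lange2023AbelianVarietiesComplex, §1.1.2] -/
theorem homPullback_apply (A : Matrix ι' ι ℤ) (θ : Additive (Multiplicative (ι' → ℤ)) →+ ℤ) :
    homPullback A θ = θ.comp (MonoidHom.toAdditive (latticeHom A)) := rfl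

/-- `(homPullback A θ)(m) = θ(A m)` on lattice vectors. [cite: Lange2023AbelianVarietiesComplex, §1.1.2] -/
@[simp]
theorem homPullback_apply_ofAdd (A : Matrix ι' ι ℤ) (θ : Additive (Multiplicative (ι' → ℤ)) →+ ℤ) (m : ι → ℤ) :
    homPullback A θ (Additive.ofMul (ofAdd m)) = θ (Additive.ofMul (ofAdd (A.mulVec m))) := rfl

/-- **`f_A^*` on coordinate characters is the TRANSPOSE of `A`**: `e'*_{a'} ∘ ρ_r(f_A) = Σ_a A_{a' a} e*_a`.
[cite: Lange2023AbelianVarietiesComplex, §1.1.2 and §1.1.3 Lemma 1.1.17 (a)] -/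
theorem homPullback_latticeCoord [DecidableEq ι] (A : Matrix ι' ι ℤ) (a' : ι') :
    homPullback A (latticeCoord a') = ∑ a, A a' a • (latticeCoord a : Additive (Multiplicative (ι → ℤ)) →+ ℤ) := by
  refine AddMonoidHom.ext fun x => ?_
  set m : ι → ℤ := toAdd (Additive.toMul x) with hm
  have hx : x = Additive.ofMul (ofAdd m) := rfl
  rw [hx, homPullback_apply_ofAdd, latticeCoord_ofAdd, AddMonoidHom.finsetSum_apply]
  change ∑ a, A a' a * m a = ∑ a, A a' a • latticeCoord a (Additive.ofMul (ofAdd m))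
  refine Finset.sum_congr rfl fun a _ => ?_
  rw [latticeCoord_ofAdd, smul_eq_mul]

end Characters

/-! ### §2 Group side: `Hⁿ(ρ_r(f_A), id) = ⋀ⁿ(ρ_r(f_A)^∨)` under `Hⁿ(Λ, ℤ) ≅ ⋀ⁿ Hom(Λ, ℤ)` -/

section GroupSide

variable {ι ι' : Type} [Fintype ι] [DecidableEq ι] [Fintype ι'] [DecidableEq ι']

local notation "𝓩Λ" => Rep.trivial ℤ (Multiplicative (ι → ℤ)) ℤ
local notation "𝓩Λ'" => Rep.trivial ℤ (Multiplicative (ι' → ℤ)) ℤ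

/-- **`f_A^*[θ₁ ∪ ⋯ ∪ θₙ] = [f_A^*θ₁ ∪ ⋯ ∪ f_A^*θₙ]`** on decomposables: the pullback
`Hⁿ(ρ_r(f_A), id)` of the class of `θ₁ ∧ ⋯ ∧ θₙ ∈ ⋀ⁿ Hom(Λ', ℤ)` is the class of
`f_A^*θ₁ ∧ ⋯ ∧ f_A^*θₙ ∈ ⋀ⁿ Hom(Λ, ℤ)`. [cite: Brown1982CohomologyGroups, V §6 p. 129; Lange2023AbelianVarietiesComplex, §1.1.6 Exercise (13)] -/
theorem groupCohomologyPullback_latticeExteriorPowerHomEquivCohomology_ιMulti (A : Matrix ι' ι ℤ) (n : ℕ)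
    (θ : Fin n → (Additive (Multiplicative (ι' → ℤ)) →+ ℤ)) :
    groupCohomologyPullback A n (latticeExteriorPowerHomEquivCohomology ι' ℤ n (exteriorPower.ιMulti ℤ n θ)) =
      latticeExteriorPowerHomEquivCohomology ι ℤ n (exteriorPower.ιMulti ℤ n fun i => homPullback A (θ i)) := by
  rw [latticeExteriorPowerHomEquivCohomology_ιMulti, latticeExteriorPowerHomEquivCohomology_ιMulti,
    groupCohomologyPullback, trivialPairHom_eq_trivialResHom, map_charCupClass]
  rfl

/-- **`Hⁿ(f) = ⋀ⁿ H¹(f)` on the group side**: `Hⁿ(ρ_r(f_A), id) ∘ (⋀ⁿ Hom(Λ', ℤ) ≅ Hⁿ(Λ', ℤ)) =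
(⋀ⁿ Hom(Λ, ℤ) ≅ Hⁿ(Λ, ℤ)) ∘ ⋀ⁿ(f_A^*|_{Hom})` — naturality of Brown's `ψ` for the lattices.
[cite: Brown1982CohomologyGroups, V §6 p. 129; Lange2023AbelianVarietiesComplex, §1.1.6 Exercise (13)] -/
theorem groupCohomologyPullback_latticeExteriorPowerHomEquivCohomology (A : Matrix ι' ι ℤ) (n : ℕ)
    (x : ⋀[ℤ]^n (Additive (Multiplicative (ι' → ℤ)) →+ ℤ)) :
    groupCohomologyPullback A n (latticeExteriorPowerHomEquivCohomology ι' ℤ n x) =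
      latticeExteriorPowerHomEquivCohomology ι ℤ n (exteriorPower.map n (homPullback A) x) := by
  have key : (groupCohomologyPullback A n).hom ∘ₗ (latticeExteriorPowerHomEquivCohomology ι' ℤ n).toLinearMap =
      (latticeExteriorPowerHomEquivCohomology ι ℤ n).toLinearMap ∘ₗ exteriorPower.map n (homPullback A) := by
    refine exteriorPower.linearMap_ext ?_
    ext θ
    simp only [LinearMap.compAlternatingMap_apply, LinearMap.coe_comp, Function.comp_apply, LinearEquiv.coe_toLinearMap,
      exteriorPower.map_apply_ιMulti]
    exact groupCohomologyPullback_latticeExteriorPowerHomEquivCohomology_ιMulti A n θ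
  exact LinearMap.congr_fun key x

end GroupSide

/-! ### §3 Torus side: `f_A^*` on `Hⁿ(X, ℤ) = integralForms Φ n` is `⋀ⁿ(f_A^*|_{H¹})` -/

section TorusSide

variable {ι ι' : Type} [Fintype ι] [LinearOrder ι] [Fintype ι'] [LinearOrder ι']
  {E E' : Type*} [NormedAddCommGroup E] [NormedSpace ℂ E] [NormedAddCommGroup E'] [NormedSpace ℂ E']
  (Φ : (ι → ℝ) ≃L[ℝ] E) (Φ' : (ι' → ℝ) ≃L[ℝ] E')

/-- **`Hⁿ(f_A) = ⋀ⁿ H¹(f_A)` for complex tori**: for the homomorphism `f_A : X = E/Φ(ℤ^ι) → X' = E'/Φ'(ℤ^ι')`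
the pullback of invariant integral `n`-forms `γ ↦ γ ∘ ρₐ(f_A)` (`realRep Φ Φ' A`), read through Lange's
canonical `Hⁿ(X, ℤ) ≅ Altⁿ(Λ, ℤ) = ⋀ⁿ Hom(Λ, ℤ)` (`latticeExteriorPowerFormsEquiv`), is the `n`-th exterior
power of `f_A^* = ρ_r(f_A)^∨` on `H¹ = Hom(Λ, ℤ)`: `(⋀ⁿ(f_A^*) x)^{form} = x^{form} ∘ ρₐ(f_A)`.
[cite: Lange2023AbelianVarietiesComplex, §1.1.2, §1.1.3 Cor. 1.1.18 and §1.1.6 Exercise (13); Brown1982CohomologyGroups, V §6 p. 129] -/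
theorem coe_latticeExteriorPowerFormsEquiv_map (A : Matrix ι' ι ℤ) (n : ℕ)
    (x : ⋀[ℤ]^n (Additive (Multiplicative (ι' → ℤ)) →+ ℤ)) :
    (latticeExteriorPowerFormsEquiv Φ n (exteriorPower.map n (homPullback A) x) : E [⋀^Fin n]→L[ℝ] ℂ) =
      (latticeExteriorPowerFormsEquiv Φ' n x : E' [⋀^Fin n]→L[ℝ] ℂ).compContinuousLinearMap (realRep Φ Φ' A) := by
  rw [latticeExteriorPowerFormsEquiv_apply, latticeExteriorPowerFormsEquiv_apply,
    ← groupCohomologyPullback_latticeExteriorPowerHomEquivCohomology, coe_groupCohomologyEquiv_map Φ Φ']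

/-- The same as an equality in `Hⁿ(X, ℤ) = integralForms Φ n` (the pulled-back form is integral by
`comp_realRep_mem_integralForms`). [cite: Lange2023AbelianVarietiesComplex, §1.1.3 Cor. 1.1.18 and §1.1.6 Exercise (13)] -/
theorem latticeExteriorPowerFormsEquiv_map (A : Matrix ι' ι ℤ) (n : ℕ)
    (x : ⋀[ℤ]^n (Additive (Multiplicative (ι' → ℤ)) →+ ℤ)) :
    latticeExteriorPowerFormsEquiv Φ n (exteriorPower.map n (homPullback A) x) =
      ⟨(latticeExteriorPowerFormsEquiv Φ' n x : E' [⋀^Fin n]→L[ℝ] ℂ).compContinuousLinearMap (realRep Φ Φ' A),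
        comp_realRep_mem_integralForms Φ Φ' A (latticeExteriorPowerFormsEquiv Φ' n x).2⟩ :=
  Subtype.ext (coe_latticeExteriorPowerFormsEquiv_map Φ Φ' A n x)

/-- On decomposables: `(f_A^*θ₁ ∧ ⋯ ∧ f_A^*θₙ)^{form} = (θ₁ ∧ ⋯ ∧ θₙ)^{form} ∘ ρₐ(f_A)`.
[cite: Lange2023AbelianVarietiesComplex, §1.1.3 Cor. 1.1.18 and §1.1.6 Exercise (13)] -/
theorem coe_latticeExteriorPowerFormsEquiv_ιMulti_homPullback (A : Matrix ι' ι ℤ) (n : ℕ)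
    (θ : Fin n → (Additive (Multiplicative (ι' → ℤ)) →+ ℤ)) :
    (latticeExteriorPowerFormsEquiv Φ n (exteriorPower.ιMulti ℤ n fun i => homPullback A (θ i)) : E [⋀^Fin n]→L[ℝ] ℂ) =
      (latticeExteriorPowerFormsEquiv Φ' n (exteriorPower.ιMulti ℤ n θ) : E' [⋀^Fin n]→L[ℝ] ℂ).compContinuousLinearMap
        (realRep Φ Φ' A) := by
  rw [← coe_latticeExteriorPowerFormsEquiv_map Φ Φ', exteriorPower.map_apply_ιMulti]
  rfl

/-- **Transport of the pullback of integral forms**: `(⋀ⁿ Hom ≅ Hⁿ(X, ℤ))⁻¹ (γ ∘ ρₐ(f_A)) =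
⋀ⁿ(f_A^*) ((⋀ⁿ Hom ≅ Hⁿ(X', ℤ))⁻¹ γ)` for `γ ∈ Hⁿ(X', ℤ)`. [cite: Lange2023AbelianVarietiesComplex, §1.1.3 Cor. 1.1.18 and §1.1.6 Exercise (13)] -/
theorem latticeExteriorPowerFormsEquiv_symm_comp_realRep (A : Matrix ι' ι ℤ) (n : ℕ) (γ : integralForms Φ' n) :
    (latticeExteriorPowerFormsEquiv Φ n).symm
        ⟨(γ : E' [⋀^Fin n]→L[ℝ] ℂ).compContinuousLinearMap (realRep Φ Φ' A), comp_realRep_mem_integralForms Φ Φ' A γ.2⟩ =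
      exteriorPower.map n (homPullback A) ((latticeExteriorPowerFormsEquiv Φ' n).symm γ) := by
  rw [AddEquiv.symm_apply_eq, latticeExteriorPowerFormsEquiv_map Φ Φ']
  congr 1
  · rw [AddEquiv.apply_symm_apply]

end TorusSide

/-! ### §4 Multiplicativity on decomposables: `(θ ∧ θ')^{form} = θ^{form} ∧ θ'^{form}` -/

section Multiplicative

variable {ι : Type} [Fintype ι] [LinearOrder ι] {E : Type*} [NormedAddCommGroup E] [NormedSpace ℂ E]
  (Φ : (ι → ℝ) ≃L[ℝ] E)

/-- **`Hⁿ(X, ℤ) ≅ ⋀ⁿ Hom(Λ, ℤ)` is multiplicative on decomposables**: the form of the concatenated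
`(p+q)`-vector `θ₁ ∧ ⋯ ∧ θ_p ∧ θ'₁ ∧ ⋯ ∧ θ'_q` (the product `(θ₁ ∧ ⋯ ∧ θ_p) · (θ'₁ ∧ ⋯ ∧ θ'_q)` in the
exterior algebra, Mathlib `ExteriorAlgebra.ιMulti_mul_ιMulti`) is the wedge of the two forms — the cup
product on `H•(X, ℤ) = ⋀• Hom(Λ, ℤ)` is the exterior product ("induced by the cup product", Lemma
1.1.17 (b) / Ex. (7); `cupProduct_charCupClass` and `groupCohomologyForm_cupProduct` BY NAME).
[cite: Lange2023AbelianVarietiesComplex, §1.1.3 Lemma 1.1.17 (b), §1.1.6 Exercises (7) and (13)] -/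
theorem coe_latticeExteriorPowerFormsEquiv_ιMulti_append {p q : ℕ}
    (θ : Fin p → (Additive (Multiplicative (ι → ℤ)) →+ ℤ)) (θ' : Fin q → (Additive (Multiplicative (ι → ℤ)) →+ ℤ)) :
    (latticeExteriorPowerFormsEquiv Φ (p + q) (exteriorPower.ιMulti ℤ (p + q) (Fin.append θ θ')) :
        E [⋀^Fin (p + q)]→L[ℝ] ℂ) =
      (latticeExteriorPowerFormsEquiv Φ p (exteriorPower.ιMulti ℤ p θ) : E [⋀^Fin p]→L[ℝ] ℂ).wedge
        (latticeExteriorPowerFormsEquiv Φ q (exteriorPower.ιMulti ℤ q θ') : E [⋀^Fin q]→L[ℝ] ℂ) := by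
  rw [coe_latticeExteriorPowerFormsEquiv_ιMulti, coe_latticeExteriorPowerFormsEquiv_ιMulti,
    coe_latticeExteriorPowerFormsEquiv_ιMulti, ← cupProduct_charCupClass, groupCohomologyForm_cupProduct]

omit [Fintype ι] [LinearOrder ι] in
/-- The decomposable `(p+q)`-vector of the concatenated word IS the product in the exterior algebra
`⋀*_ℤ Hom(Λ, ℤ)` of the two decomposables (Mathlib `ExteriorAlgebra.ιMulti_mul_ιMulti`, recorded on the
lane's carrier). [cite: Brown1982CohomologyGroups, V §6 p. 128 (the product `v ∧ w` of `⋀*(V)`)] -/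
theorem coe_ιMulti_append_eq_mul {p q : ℕ}
    (θ : Fin p → (Additive (Multiplicative (ι → ℤ)) →+ ℤ)) (θ' : Fin q → (Additive (Multiplicative (ι → ℤ)) →+ ℤ)) :
    ((exteriorPower.ιMulti ℤ (p + q) (Fin.append θ θ') : ⋀[ℤ]^(p + q) (Additive (Multiplicative (ι → ℤ)) →+ ℤ)) :
        ExteriorAlgebra ℤ (Additive (Multiplicative (ι → ℤ)) →+ ℤ)) =
      (exteriorPower.ιMulti ℤ p θ : ExteriorAlgebra ℤ _) * (exteriorPower.ιMulti ℤ q θ' : ExteriorAlgebra ℤ _) := by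
  rw [exteriorPower.ιMulti_apply_coe, exteriorPower.ιMulti_apply_coe, exteriorPower.ιMulti_apply_coe,
    ExteriorAlgebra.ιMulti_mul_ιMulti]

end Multiplicative

end ComplexTorus

end Literature.Geometry.Kaehler

end
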